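import Summits.NavierStokesRegularity.NavierStokesRegularity.Theorems.StrainDoorsSpacetimeRecord
import Literature.Analysis.FluidPDE.LeraySelfSimilarCalculus
import HarnessLib

/-!
# StrainDoorsSpacetimeRecords — the records theorem, the peak law, the ancient form, DSS scaling

nsreg-p1 g34, ROUND-52 PART 2 (imports PART 1 `StrainDoorsSpacetimeRecord`; helper lane of
`stmt-NavierStokesRegularity-0056`, rung N0; text for the S-lane).

* §4 ★★ `strainNumber_records` — a continuous majorant `M` of the strain number density on `[t₀,t₁]`, attained at
  every time, that RISES (`M(t₀) < M(t₁)`) has a running record `t* ∈ (t₀,t₁]` with `M(t*) ≥ M(t₁)` and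
  `M(t*)·(1 + M(t*)) ≤ (T − t*)²·H` there (record defect `≥ 1/M(t*)`); ★ `strainNumber_peak_law` (interior peak of a
  majorant); ★ `ancient_spacetime_record_law` (`S = (−∞,T)`: an attained space-time supremum `N*` of the strain number
  density of an ancient — e.g. DSS — classical solution has record defect `≥ 1/N*`: referee F4's profile inequality
  `c_∞ − 1 ≥ 1/C_Λ` on the DSS class, conditional only on attainment).
* §4½ ★ `strain_running_max_law` — the `T = ∞` form: at a running maximum of the strain itself (`q(t,x,e)`
  dominates `q(s,y,e')`, `s ≤ t` close), `q² ≤ H`: `λ₁² + ∇²p(e₁,e₁) ≤ ¼|ω × e₁|²` at every new high of the strain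
  (DNS-checkable, no reference time).
* §5 `strainQuad_nsRescale`, `strainNumber_nsRescale`, `IsDiscretelySelfSimilar.strainNumber_eq` — the strain number
  density is invariant under the Navier–Stokes scaling; for a `λ`-DSS field `N(λ²t, λx, e) = N(t, x, e)`, so its
  supremum over all `t < 0` is a supremum over one period.

WHAT THIS IS NOT: no blow-up or profile is excluded; `0056`/NS regularity are not proved.  No new definitions; no sorry.
-/

noncomputable section

open MeasureTheory Set Function Filter Metric Real InnerProductSpace
open _root_.Topology
open scoped ENNReal NNReal RealInnerProductSpace ContDiff Laplacian
open Literature.Analysis Literature.Analysis.FluidPDE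
open Literature.Analysis.FluidPDE.VorticityDirectionDynamics

set_option linter.dupNamespace false

namespace Summit.NavierStokesRegularity.NavierStokesRegularity.Theorems.StrainDoors

open Summit.NavierStokesRegularity.NavierStokesRegularity.Theorems.ArgmaxDoors

/-! ## §4 The peak law for a majorant of the strain number, and the ancient / attained-supremum form -/

/-- ★ **THE PEAK LAW.**  Let `M : ℝ → ℝ` majorise the strain number on `S` — `(T − s)·q(s,y,e') ≤ M(s)` for all
`s ∈ S`, `y`, unit `e'` (e.g. `M(s) = (T − s)·Λ(s)`) — be ATTAINED at time `t` at `(x,e)` (`M(t) = (T − t)·q(t,x,e)`),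
and have a local maximum at the interior time `t < T`.  Then `(t,x,e)` is a space-time record and
`M(t)·(1 + M(t)) ≤ (T − t)²·H(t,x,e)`: an interior peak of the strain number of height `M` costs record defect
`≥ 1/M`. [folklore] -/
theorem strainNumber_peak_law {ν T : ℝ} {S : Set ℝ}
    {u : ℝ → (EuclideanSpace ℝ (Fin 3)) → (EuclideanSpace ℝ (Fin 3))} {p : ℝ → (EuclideanSpace ℝ (Fin 3)) → ℝ}
    (hν : 0 ≤ ν) (hS : UniqueDiffOn ℝ S) (hcl : S ⊆ closure (interior S))
    (hsol : IsClassicalNSSolutionOn S ν 0 u p)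
    {t : ℝ} (ht : S ∈ 𝓝 t) (htT : t < T) {x e : EuclideanSpace ℝ (Fin 3)} (he : ‖e‖ = 1)
    {M : ℝ → ℝ}
    (hM : ∀ s ∈ S, ∀ (y e' : EuclideanSpace ℝ (Fin 3)), ‖e'‖ = 1 → (T - s) * strainQuad u s y e' ≤ M s)
    (hMt : M t = (T - t) * strainQuad u t x e) (hpeak : IsLocalMax M t) :
    M t + M t ^ 2 ≤ (T - t) ^ 2 * strainFeed u p t x e := by
  have ht' : t ∈ S := mem_of_mem_nhds ht
  have hTt : 0 < T - t := sub_pos.mpr htT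
  have hmaxX : ∀ y, strainQuad u t y e ≤ strainQuad u t x e := by
    intro y
    have h1 := hM t ht' y e he
    rw [hMt] at h1
    exact le_of_mul_le_mul_left h1 hTt
  have hmaxT : IsLocalMax (fun s => (T - s) * strainQuad u s x e) t := by
    have hS' : ∀ᶠ s in 𝓝 t, s ∈ S := ht
    filter_upwards [hpeak, hS'] with s hs hsS
    calc (T - s) * strainQuad u s x e ≤ M s := hM s hsS x e he
      _ ≤ M t := hs
      _ = (T - t) * strainQuad u t x e := hMt
  rw [hMt]
  exact spacetime_record_law hν hS hcl hsol ht he hmaxX hmaxT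

/-- ★★ **THE RECORDS THEOREM** (what a rising strain number must pay).  Classical solution on `S` (`ν ≥ 0`); a time
segment `[t₀,t₁] ⊆ S` of interior times after `t₀` (`S ∈ 𝓝 s` for `t₀ < s ≤ t₁`), `t₁ < T`; a function `M` that on
`[t₀,t₁]` is continuous, MAJORISES the strain number density (`(T − s)·q(s,y,e') ≤ M(s)`, unit `e'`) and is ATTAINED
(`M(s) = (T − s)·q(s,x_s,e_s)` for some `x_s`, unit `e_s` — e.g. `M(s) = (T − s)·Λ(s)` with the strain supremum
attained); and the strain number RISES on the segment: `M(t₀) < M(t₁)`.  Then there is a RUNNING RECORD: a time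
`t* ∈ (t₀,t₁]` and `(x,e)` with `M(t*) = (T − t*)·q(t*,x,e) ≥ M(t₁)`, `M(s) ≤ M(t*)` for all `s ∈ [t₀,t*]`, at which
`M(t*)·(1 + M(t*)) ≤ (T − t*)²·H(t*,x,e)` — record defect `≥ 1/M(t*)`, at a strain number `M(t*) ≥ M(t₁)`.
(`t*` = a maximiser of `M` on the compact segment; it is not `t₀` because the number rose.)  Along a blow-up whose
strain number keeps exceeding its earlier values this produces records `t*ₖ → T` with `M(t*ₖ) ↑ sup M` and record
defects `≥ 1/sup M` — door D12's law at the records, constant `1`, outside any finite-energy frame. [folklore] -/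
theorem strainNumber_records {ν T t₀ t₁ : ℝ} {S : Set ℝ}
    {u : ℝ → (EuclideanSpace ℝ (Fin 3)) → (EuclideanSpace ℝ (Fin 3))} {p : ℝ → (EuclideanSpace ℝ (Fin 3)) → ℝ}
    (hν : 0 ≤ ν) (hS : UniqueDiffOn ℝ S) (hcl : S ⊆ closure (interior S))
    (hsol : IsClassicalNSSolutionOn S ν 0 u p)
    (h01 : t₀ < t₁) (ht₁T : t₁ < T) (hint : ∀ s ∈ Ioc t₀ t₁, S ∈ 𝓝 s)
    {M : ℝ → ℝ} (hMc : ContinuousOn M (Icc t₀ t₁))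
    (hM : ∀ s ∈ Icc t₀ t₁, ∀ (y e' : EuclideanSpace ℝ (Fin 3)), ‖e'‖ = 1 → (T - s) * strainQuad u s y e' ≤ M s)
    (hMatt : ∀ s ∈ Icc t₀ t₁, ∃ (x e : EuclideanSpace ℝ (Fin 3)), ‖e‖ = 1 ∧ M s = (T - s) * strainQuad u s x e)
    (hrise : M t₀ < M t₁) :
    ∃ tr ∈ Ioc t₀ t₁, ∃ (x e : EuclideanSpace ℝ (Fin 3)), ‖e‖ = 1 ∧ M tr = (T - tr) * strainQuad u tr x e ∧
      M t₁ ≤ M tr ∧ (∀ s ∈ Icc t₀ tr, M s ≤ M tr) ∧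
      M tr + M tr ^ 2 ≤ (T - tr) ^ 2 * strainFeed u p tr x e := by
  have hne : (Icc t₀ t₁).Nonempty := nonempty_Icc.mpr h01.le
  obtain ⟨tr, htr, hmax⟩ := isCompact_Icc.exists_isMaxOn hne hMc
  have hM1 : M t₁ ≤ M tr := hmax (right_mem_Icc.mpr h01.le)
  have htr0 : t₀ < tr := by
    rcases eq_or_lt_of_le htr.1 with h | h
    · exfalso
      rw [← h] at hM1
      linarith
    · exact h
  have htrI : tr ∈ Ioc t₀ t₁ := ⟨htr0, htr.2⟩
  obtain ⟨x, e, he, hMtr⟩ := hMatt tr htr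
  have hrecM : ∀ s ∈ Icc t₀ tr, M s ≤ M tr := fun s hs => hmax ⟨hs.1, hs.2.trans htr.2⟩
  refine ⟨tr, htrI, x, e, he, hMtr, hM1, hrecM, ?_⟩
  have ht : S ∈ 𝓝 tr := hint tr htrI
  have htrT : tr < T := lt_of_le_of_lt htr.2 ht₁T
  -- the running-record hypothesis at `(tr, x, e)`
  have hrec : ∀ᶠ s in 𝓝[≤] tr, ∀ (y e' : EuclideanSpace ℝ (Fin 3)), ‖e'‖ = 1 →
      (T - s) * strainQuad u s y e' ≤ (T - tr) * strainQuad u tr x e := by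
    have h1 : ∀ᶠ s in 𝓝[≤] tr, t₀ < s := by
      have : ∀ᶠ s in 𝓝 tr, t₀ < s := Ioi_mem_nhds htr0
      exact this.filter_mono nhdsWithin_le_nhds
    have h2 : ∀ᶠ s in 𝓝[≤] tr, s ≤ tr := eventually_mem_nhdsWithin
    filter_upwards [h1, h2] with s hs1 hs2 y e' he'
    have hsI : s ∈ Icc t₀ t₁ := ⟨hs1.le, hs2.trans htr.2⟩
    calc (T - s) * strainQuad u s y e' ≤ M s := hM s hsI y e' he'
      _ ≤ M tr := hrecM s ⟨hs1.le, hs2⟩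
      _ = (T - tr) * strainQuad u tr x e := hMtr
  rw [hMtr]
  exact running_record_law hν hS hcl hsol ht htrT he hrec

/-- ★ **ANCIENT / ATTAINED-SUPREMUM FORM.**  Classical solution on the OPEN time set `(−∞, T)` (every time is
interior; an ancient solution, e.g. a DSS blow-up at `T`).  If the strain number density `(T − s)·q(s,y,e')` attains
its supremum over ALL `s < T`, `y`, unit `e'` at `(t,x,e)` and that supremum `N* = (T − t)·q(t,x,e)` is positive, then
the record defect there is at least `1/N*`:  `((H − q²)/q²)·N* ≥ 1`.  For a DSS solution the supremum over all times
is a supremum over one period (§5), so only SPATIAL attainment is at stake. [folklore] -/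
theorem ancient_spacetime_record_law {ν T : ℝ}
    {u : ℝ → (EuclideanSpace ℝ (Fin 3)) → (EuclideanSpace ℝ (Fin 3))} {p : ℝ → (EuclideanSpace ℝ (Fin 3)) → ℝ}
    (hν : 0 ≤ ν) (hsol : IsClassicalNSSolutionOn (Iio T) ν 0 u p)
    {t : ℝ} (htT : t < T) {x e : EuclideanSpace ℝ (Fin 3)} (he : ‖e‖ = 1)
    (hsup : ∀ s < T, ∀ (y e' : EuclideanSpace ℝ (Fin 3)), ‖e'‖ = 1 →
      (T - s) * strainQuad u s y e' ≤ (T - t) * strainQuad u t x e)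
    (hq : 0 < strainQuad u t x e) :
    1 ≤ (strainFeed u p t x e - (strainQuad u t x e) ^ 2) / (strainQuad u t x e) ^ 2
          * ((T - t) * strainQuad u t x e) := by
  have hS : UniqueDiffOn ℝ (Iio T) := uniqueDiffOn_Iio T
  have hcl : Iio T ⊆ closure (interior (Iio T)) := by
    rw [interior_Iio]
    exact subset_closure
  have ht : Iio T ∈ 𝓝 t := Iio_mem_nhds htT
  have hTt : 0 < T - t := sub_pos.mpr htT
  have hmaxX : ∀ y, strainQuad u t y e ≤ strainQuad u t x e := fun y =>
    le_of_mul_le_mul_left (hsup t htT y e he) hTt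
  have hmaxT : IsLocalMax (fun s => (T - s) * strainQuad u s x e) t := by
    have hS' : ∀ᶠ s in 𝓝 t, s ∈ Iio T := ht
    filter_upwards [hS'] with s hs
    exact hsup s hs x e he
  exact spacetime_defect_law hν hS hcl hsol ht htT he hmaxX hmaxT hq

/-! ## §4½ The `T = ∞` form: a running maximum of the strain itself -/

/-- ★ **THE RUNNING-MAXIMUM LAW FOR THE STRAIN** (the reference time sent to `+∞`).  Classical solution on `S`
(`ν ≥ 0`), interior time `t`, unit `e`.  If `q(t,x,e) = ⟪∇u(t,x)e,e⟫` dominates `q(s,y,e')` for all `(y,e')` and all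
times `s ≤ t` close to `t` — a running maximum of the largest strain eigenvalue `Λ(s) = sup λ₁(S(s,·))`, attained at
`(x,e)` — then the feed exceeds the square there:  `q² ≤ H = ¼(|ω|² − ⟪ω,e⟫²) − ∇²p(e,e)`, i.e.
`λ₁² + ∇²p(e₁,e₁) ≤ ¼|ω × e₁|²` at every new high of the strain.  (One-sided Fermat `∂ₜq ≥ 0` + E1_S⁺ + `Δ_x q ≤ 0`.)
A DNS-checkable necessary condition at strain records, with no reference time. [folklore] -/
theorem strain_running_max_law {ν : ℝ} {S : Set ℝ}
    {u : ℝ → (EuclideanSpace ℝ (Fin 3)) → (EuclideanSpace ℝ (Fin 3))} {p : ℝ → (EuclideanSpace ℝ (Fin 3)) → ℝ}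
    (hν : 0 ≤ ν) (hS : UniqueDiffOn ℝ S) (hcl : S ⊆ closure (interior S))
    (hsol : IsClassicalNSSolutionOn S ν 0 u p)
    {t : ℝ} (ht : S ∈ 𝓝 t) {x e : EuclideanSpace ℝ (Fin 3)} (he : ‖e‖ = 1)
    (hrec : ∀ᶠ s in 𝓝[≤] t, ∀ (y e' : EuclideanSpace ℝ (Fin 3)), ‖e'‖ = 1 →
      strainQuad u s y e' ≤ strainQuad u t x e) :
    (strainQuad u t x e) ^ 2 ≤ strainFeed u p t x e := by
  have ht' : t ∈ S := mem_of_mem_nhds ht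
  have hu : ContDiff ℝ ∞ (u t) := hsol.smooth_velocity.contDiff_slice ht'
  have hnow := hrec.self_of_nhdsWithin (mem_Iic.mpr le_rfl)
  have hmaxX : ∀ y, strainQuad u t y e ≤ strainQuad u t x e := fun y => hnow y e he
  have hloc : IsLocalMax (fun y => strainQuad u t y e) x := Filter.Eventually.of_forall fun y => hmaxX y
  have hcrit : fderiv ℝ (fun y => ⟪fderiv ℝ (u t) y e, e⟫) x = 0 := hloc.fderiv_eq_zero
  -- E1_S⁺ at the critical point, with the frame identity on `S`
  have hframe := strainFrame_on hS hcl hsol ht' x e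
  have hE := strainGrowthViscous_holds ν (u t) (p t) hu x e he hcrit _ hframe
  obtain ⟨R, hRdef⟩ : ∃ R : ℝ, R = ⟪timeDerivWithin S (fun s y => fderiv ℝ (u s) y e) t x, e⟫ := ⟨_, rfl⟩
  rw [← hRdef] at hE
  have hE' : R ≤ -(strainQuad u t x e) ^ 2 + strainFeed u p t x e + ν * strainLap u t x e := by
    unfold strainLap strainFeed pressureHess strainQuad
    linarith [hE]
  -- one-sided Fermat for `q` itself: `0 ≤ ∂ₜq`
  have hq : HasDerivAt (fun s => strainQuad u s x e) R t := by
    rw [hRdef]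
    exact (hasDerivWithinAt_strainQuad hsol.smooth_velocity hS ht' x e).hasDerivAt ht
  have hrec' : IsLocalMaxOn (fun s => strainQuad u s x e) (Iic t) t := by
    show ∀ᶠ s in 𝓝[Iic t] t, strainQuad u s x e ≤ strainQuad u t x e
    filter_upwards [hrec] with s hs
    exact hs x e he
  have hR : 0 ≤ R := hasDerivAt_nonneg_of_isLocalMaxOn_Iic hrec' hq
  -- second-order condition
  have hmaxX' : ∀ y, ⟪fderiv ℝ (u t) y e, e⟫ ≤ ⟪fderiv ℝ (u t) x e, e⟫ := hmaxX
  have h1 := inner_fderiv_laplacian_le_zero_of_isMax hu x e hmaxX'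
  rw [inner_fderiv_laplacian_eq_laplacian_strain hu x e] at h1
  have h1' : strainLap u t x e ≤ 0 := h1
  have h3 : ν * strainLap u t x e ≤ 0 := mul_nonpos_of_nonneg_of_nonpos hν h1'
  nlinarith [hE', hR, h3]

/-! ## §5 Scaling: the strain number density is invariant under the Navier–Stokes rescaling (DSS periodicity) -/

/-- `q` of the rescaled field: `strainQuad (nsRescale c u) t x e = c²·strainQuad u (c²t) (c x) e`
(`D(c • u(c ·)) = c² • Du(c ·)`, `fderiv_smul_comp_smul`). [folklore] -/
theorem strainQuad_nsRescale (c : ℝ) (u : ℝ → (EuclideanSpace ℝ (Fin 3)) → (EuclideanSpace ℝ (Fin 3)))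
    (t : ℝ) (x e : EuclideanSpace ℝ (Fin 3)) :
    strainQuad (nsRescale c u) t x e = c ^ 2 * strainQuad u (c ^ 2 * t) (c • x) e := by
  unfold strainQuad
  have h : nsRescale c u t = fun y => c • u (c ^ 2 * t) (c • y) := rfl
  rw [h, fderiv_smul_comp_smul, _root_.smul_apply, real_inner_smul_left]

/-- **The strain number density is scaling-invariant** (blow-up at the space-time origin, `T = 0`): for the rescaled
field, `(0 − t)·q_{u_c}(t,x,e) = (0 − c²t)·q_u(c²t, cx, e)`. [folklore] -/
theorem strainNumber_nsRescale (c : ℝ) (u : ℝ → (EuclideanSpace ℝ (Fin 3)) → (EuclideanSpace ℝ (Fin 3)))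
    (t : ℝ) (x e : EuclideanSpace ℝ (Fin 3)) :
    (0 - t) * strainQuad (nsRescale c u) t x e = (0 - c ^ 2 * t) * strainQuad u (c ^ 2 * t) (c • x) e := by
  rw [strainQuad_nsRescale]
  ring

/-- **DSS periodicity of the strain number.** For a `λ`-DSS field `u` (`nsRescale λ u = u`; blow-up at the origin):
`(0 − t)·q(t,x,e) = (0 − λ²t)·q(λ²t, λx, e)` — the strain number density takes the same values on every period
`t ∈ [−λ²ᵏ⁺², −λ²ᵏ)`, so its supremum over all `t < 0` is its supremum over one period. [folklore] -/
theorem _root_.Literature.Analysis.FluidPDE.IsDiscretelySelfSimilar.strainNumber_eq {c : ℝ}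
    {u : ℝ → (EuclideanSpace ℝ (Fin 3)) → (EuclideanSpace ℝ (Fin 3))} (h : IsDiscretelySelfSimilar c u)
    (t : ℝ) (x e : EuclideanSpace ℝ (Fin 3)) :
    (0 - t) * strainQuad u t x e = (0 - c ^ 2 * t) * strainQuad u (c ^ 2 * t) (c • x) e := by
  have h1 := strainNumber_nsRescale c u t x e
  have h2 : nsRescale c u = u := h
  rw [h2] at h1
  exact h1

end Summit.NavierStokesRegularity.NavierStokesRegularity.Theorems.StrainDoors
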